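import Mathlib
import HarnessLib
import Summits.CriticalPhenomena.CardyFormulaZ2.Theses.CardySelfRefinement
import Literature.Probability.RandomPlanarGeometry.ChordalReversibility
import Literature.Probability.RandomPlanarGeometry.ConformalRectangle
import Literature.Probability.RandomPlanarGeometry.IsometryCovariance
import Summits.CriticalPhenomena.CardyFormulaZ2.Theorems.CardySelfRefinementLagHandOffNoTraceArms
import Literature.Probability.LatticeModels.FKIsingInterfaceTightnessProofs
import Literature.Probability.Percolation.HalfPlaneArmDiagonalInputs
import Literature.Probability.Percolation.HalfPlaneUCatch
import Literature.Probability.Percolation.LatticeSymmetry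

/-!
# One visit of the bond-`ℤ²` exploration near the free arc forces an open arm INSIDE the domain;
# lattice geometry of a diagonal wall

Helper file for stub `stub_touchExponent` (S3) of line `SketchIdeatorTwo` of crux `SymmetryUpgradeR`
(stmt-CriticalPhenomena-17239, route CardySelfRefinement), stage T4b, part 1 (deterministic).

* `touchExponent_inDomainArmOfVisit` (registered) — for admissible discrete Dobrushin data whose
  discrete marked points and discrete WIRED arc stay away from a point `z`, a visit of the medial
  exploration polygon to `B̄(z, ρ')` forces an `ω`-OPEN lattice path through vertices of the
  discrete domain `Ω_δ`, within `r/8 + δ` of `z`, from `B̄(z, ρ' + δ)` to distance `≥ r/8 - δ`: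
  the chain of LEFT vertices of the darts of a tight traversal of the shell `D(z; ρ', r/8)`
  (Aizenman–Burchard 1999, App. A; Smirnov 2001, §2: open edges on the left of the exploration;
  the tree's `left_step_of_untainted`, `cv_mem_meshDomain`, `exists_isTraversal_of_visit`,
  `forall_corner_not_mem_of_far`). Unlike `arm_of_visit` of `…LagHandOffNoTraceArms` the arm is
  confined to `Ω_δ`, which is what a HALF-plane arm estimate needs.
* Lattice geometry of the diagonal wall `{re + im = -1}` of the triangle
  `Δ = {re < 0, im < 0, re + im > -1}` at mesh `δ`: sites of `Δ` lie in `{v₀ + v₁ ≥ ⌊-1/δ⌋ + 1}`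
  (`touchExponent_level_le_hgtOf`); a base point of the wall within `3δ` of `z = -(1+i)/2`
  (`touchExponent_dist_base_le`); the half-plane norm `ν_b = max |Δcol| (Δhgt)` versus the
  Euclidean distance (`touchExponent_norm_le_dist`, `touchExponent_dist_le_norm`); clipping an
  in-domain arm to the two-scale half-plane arm event of T3 (`touchExponent_clip_halfAnnulus`)
  and its translation to level `0` (`touchExponent_real_shift_level`).
-/

noncomputable section

namespace Summit.CriticalPhenomena.CardyFormulaZ2.Theorems.SymmetryUpgradeR.SwallowingSkeleton

open MeasureTheory Filter Set Metric
open Literature.Probability.RandomPlanarGeometry Literature.Probability.LatticeModels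
  Literature.Probability.Percolation
open UpperHalfPlane (upperHalfPlaneSet)
open Literature.Probability.Percolation.TrackExchange
open Literature.Probability.LatticeModels.IsMedialExploration
open Summit.CriticalPhenomena.CardyFormulaZ2.Cruxes.LagHandOff.HittingTournament
  (tIdx_lt_length dist_polyline_cv_le' forall_corner_not_mem_of_far
    dist_meshPoint_ge_of_mem_zdDiscreteArc exists_isTraversal_of_visit)
open scoped unitInterval Topology

local notation3 "ν[" b ", " v "]" => max |col v - col b| (hgtOf v - hgtOf b)
local notation3 "μ" => bondPercolation (zdGraph 2) half

/-! ### Chains of open edges -/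

/-- A finite chain of sites, consecutive ones equal or joined by an open edge, all in `S`, is an
open connection inside `S` between its ends. -/
theorem touchExponent_openConnIn_of_chain {S : Set (Site 2)} {ω : BondConfig (Site 2)} (f : ℕ → Site 2)
    (N : ℕ) (hS : ∀ j ≤ N, f j ∈ S)
    (hstep : ∀ j < N, f j = f (j + 1) ∨ (s(f j, f (j + 1)) ∈ ω ∧ f j ≠ f (j + 1))) :
    ω ∈ openConnIn S (f 0) (f N) := by
  induction N with
  | zero => exact ⟨hS 0 le_rfl, hS 0 le_rfl, SimpleGraph.Reachable.refl _⟩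
  | succ N ih =>
    obtain ⟨h0, hN, hr⟩ := ih (fun j hj => hS j (Nat.le_succ_of_le hj))
      (fun j hj => hstep j (Nat.lt_succ_of_lt hj))
    refine ⟨h0, hS (N + 1) le_rfl, hr.trans ?_⟩
    rcases hstep N (Nat.lt_succ_self N) with h | ⟨hω, hne⟩
    · have : (⟨f N, hN⟩ : S) = ⟨f (N + 1), hS (N + 1) le_rfl⟩ := Subtype.ext h
      rw [this]
    · refine SimpleGraph.Adj.reachable ?_
      rw [SimpleGraph.induce_adj, openGraph_adj]
      exact ⟨hω, hne⟩

/-! ### A clean traversal gives an open arm INSIDE the discrete domain -/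

section Arms

variable {D' : DiscreteDobrushin} {ω : BondConfig (Site 2)} {a : MedialVertex}
  {l : List MedialVertex}

/-- **A traversal whose left vertices avoid the wired arc gives an open arm of `ω` inside the
discrete domain.** If the exploration polygon traverses the shell `D(x; ρ, R)` between the times
`s ≤ t` while staying in `B̄(x, R)`, and no left vertex of the darts traversed in between lies on
the discrete arc `A`, then the left vertices form an `ω`-open path through vertices of `Ω_δ`
within `R + δ` of `x`, from `B̄(x, ρ + δ)` to distance `≥ R - δ` from `x`. -/
theorem touchExponent_inDomainArm_of_traversal (hexp : IsMedialExploration D' ω (a :: l))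
    (hδ : 0 < D'.δ) {x : ℂ} {ρ R : ℝ} {s t : I}
    (htr : (⟨polyline ((a :: l).map (medialPoint D'.δ))⟩ : Curve ℂ).IsTraversal x ρ R s t)
    (hin : ∀ u, s ≤ u → u ≤ t → dist (polyline ((a :: l).map (medialPoint D'.δ)) u) x ≤ R)
    (hA : ∀ i, tIdx l s ≤ i → i ≤ tIdx l t → hexp.cv i ∉ D'.zdArcA) :
    ∃ v w : Site 2, dist (meshPoint D'.δ v) x ≤ ρ + D'.δ ∧ R - D'.δ ≤ dist (meshPoint D'.δ w) x ∧
      ω ∈ openConnIn (meshDomain D'.Ω D'.δ ∩ {y | dist (meshPoint D'.δ y) x ≤ R + D'.δ}) v w := by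
  set i₀ := tIdx l s with hi₀
  set i₁ := tIdx l t with hi₁
  have h01 : i₀ ≤ i₁ := tIdx_mono l htr.1
  have hi₁l : i₁ < ((a :: l).zip l).length := tIdx_lt_length hexp t
  have hcurve : ∀ u, (⟨polyline ((a :: l).map (medialPoint D'.δ))⟩ : Curve ℂ) u =
      polyline ((a :: l).map (medialPoint D'.δ)) u := fun u => rfl
  -- every left vertex in between is a vertex of `Ω_δ` within `R + δ` of `x`
  have hmem : ∀ i, i₀ ≤ i → i ≤ i₁ →
      hexp.cv i ∈ meshDomain D'.Ω D'.δ ∩ {y | dist (meshPoint D'.δ y) x ≤ R + D'.δ} := by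
    intro i h0 h1
    refine ⟨hexp.cv_mem_meshDomain (h1.trans_lt hi₁l), ?_⟩
    obtain ⟨u, hsu, hut, hu⟩ := exists_time_of_tIdx l htr.1 h0 h1
    have hd := dist_polyline_cv_le' hexp hδ.le u
    rw [hu] at hd
    have hux := hin u hsu hut
    show dist (meshPoint D'.δ (hexp.cv i)) x ≤ R + D'.δ
    linarith [dist_triangle (meshPoint D'.δ (hexp.cv i))
      (polyline ((a :: l).map (medialPoint D'.δ)) u) x,
      dist_comm (polyline ((a :: l).map (medialPoint D'.δ)) u) (meshPoint D'.δ (hexp.cv i))]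
  -- the chain of left vertices
  have hconn : ω ∈ openConnIn (meshDomain D'.Ω D'.δ ∩ {y | dist (meshPoint D'.δ y) x ≤ R + D'.δ})
      (hexp.cv i₀) (hexp.cv i₁) := by
    have key := touchExponent_openConnIn_of_chain (S := meshDomain D'.Ω D'.δ ∩
        {y | dist (meshPoint D'.δ y) x ≤ R + D'.δ}) (ω := ω) (fun j => hexp.cv (i₀ + j)) (i₁ - i₀)
      (fun j hj => hmem _ (by omega) (by omega)) (fun j hj => ?_)
    · simpa [Nat.add_sub_cancel' h01] using key
    · have h1 : 1 ≤ i₀ + j + 1 := by omega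
      have h2 : i₀ + j + 1 < ((a :: l).zip l).length := by omega
      rcases left_step_of_untainted hexp h1 h2 (hA _ (by omega) (by omega)) with h | ⟨hω, hadj⟩
      · left; simpa [add_assoc] using h
      · right
        simp only [Nat.add_sub_cancel] at hω hadj
        exact ⟨by simpa [add_assoc] using hω, by simpa [add_assoc] using hadj.ne⟩
  -- the two ends
  have hs' := dist_polyline_cv_le' hexp hδ.le s
  have ht' := dist_polyline_cv_le' hexp hδ.le t
  rw [← hi₀] at hs'
  rw [← hi₁] at ht'
  have h1 := dist_triangle (meshPoint D'.δ (hexp.cv i₀))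
    (polyline ((a :: l).map (medialPoint D'.δ)) s) x
  have h2 := dist_triangle (polyline ((a :: l).map (medialPoint D'.δ)) t)
    (meshPoint D'.δ (hexp.cv i₁)) x
  have h3 := dist_triangle (polyline ((a :: l).map (medialPoint D'.δ)) s)
    (meshPoint D'.δ (hexp.cv i₀)) x
  have h4 := dist_triangle (meshPoint D'.δ (hexp.cv i₁))
    (polyline ((a :: l).map (medialPoint D'.δ)) t) x
  rw [dist_comm] at hs' ht'
  have hs'' := hs'
  have ht'' := ht'
  rw [dist_comm] at hs'' ht''
  rcases htr.2 with ⟨hnear, hfar⟩ | ⟨hfar, hnear⟩ <;> rw [hcurve] at hnear hfar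
  · exact ⟨hexp.cv i₀, hexp.cv i₁, by linarith, by linarith, hconn⟩
  · refine ⟨hexp.cv i₁, hexp.cv i₀, by linarith, by linarith, ?_⟩
    rwa [openConnIn_comm] at hconn

/-- **One visit near a point of the free arc forces an open arm inside the domain, at a fixed
mesh.** Let the admissible data `D'` (mesh `δ ≤ r/64`) have both discrete marked points at
distance `≥ 3r/4` from a point `z`, and all sites of its discrete wired arc `A` at distance
`≥ 3r/8` from `z`. If the exploration polygon of `ω` visits `B̄(z, ρ')` with `2ρ' ≤ r/8`, then `ω`
contains an open path through vertices of `Ω_δ` within `r/8 + δ` of `z`, from `B̄(z, ρ' + δ)` to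
distance `≥ r/8 - δ` from `z`. -/
theorem touchExponent_inDomainArm_of_visit {D' : DiscreteDobrushin} (hadm : D'.IsZdAdmissible)
    {z : ℂ} {r : ℝ} (hδr : D'.δ ≤ r / 64)
    (hends : ∀ p ∈ medialPoint D'.δ '' D'.zdABEdges, 3 * r / 4 ≤ dist p z)
    (hside : ∀ v ∈ D'.zdArcA, 3 * r / 8 ≤ dist (meshPoint D'.δ v) z)
    {ρ' : ℝ} (hρ'r : 2 * ρ' ≤ r / 8) {ω : BondConfig (Site 2)}
    (hvisit : ∃ u, dist (medialExplorationCurve D' ω u) z ≤ ρ') :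
    ∃ v w : Site 2, dist (meshPoint D'.δ v) z ≤ ρ' + D'.δ ∧
      r / 8 - D'.δ ≤ dist (meshPoint D'.δ w) z ∧
      ω ∈ openConnIn (meshDomain D'.Ω D'.δ ∩ {y | dist (meshPoint D'.δ y) z ≤ r / 8 + D'.δ}) v w := by
  have hδ : 0 < D'.δ := hadm.delta_pos
  have hγ := isMedialExploration_medialExploration_holds D' hadm ω
  obtain ⟨a, l, hal⟩ := List.exists_cons_of_ne_nil hγ.ne_nil
  rw [hal] at hγ
  have hcurve_eq : medialExplorationCurve D' ω = polyline ((a :: l).map (medialPoint D'.δ)) := by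
    rw [medialExplorationCurve, hal]
  obtain ⟨u₀, hu₀⟩ := hvisit
  rw [hcurve_eq] at hu₀
  -- the polygon starts at a discrete marked point, far from `z`
  have h0 : r / 8 ≤ dist (polyline ((a :: l).map (medialPoint D'.δ)) 0) z := by
    rw [List.map_cons, polyline_apply_zero]
    have := hends _ ⟨a, hγ.head_mem, rfl⟩
    linarith
  obtain ⟨s, t, htr, hin⟩ := exists_isTraversal_of_visit
    (polyline ((a :: l).map (medialPoint D'.δ))) (by linarith : ρ' < r / 8) h0 hu₀
  have hfar := (forall_corner_not_mem_of_far hγ hδ.le htr.1 hin (S := D'.zdArcA)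
    (fun v hv => by have := hside v hv; linarith)).1
  exact touchExponent_inDomainArm_of_traversal hγ hδ htr hin hfar

/-- **Registered form `touchExponent_inDomainArmOfVisit`** (explicit arguments) of
`touchExponent_inDomainArm_of_visit`: one visit of the exploration polygon near a point far from
the discrete marked points and from the discrete wired arc forces an open arm of `ω` inside the
discrete domain. -/
theorem touchExponent_inDomainArmOfVisit : ∀ (D' : DiscreteDobrushin), D'.IsZdAdmissible → ∀ (z : ℂ) (r : ℝ), D'.δ ≤ r / 64 → (∀ p ∈ medialPoint D'.δ '' D'.zdABEdges, 3 * r / 4 ≤ dist p z) → (∀ v ∈ D'.zdArcA, 3 * r / 8 ≤ dist (meshPoint D'.δ v) z) → ∀ (ρ' : ℝ), 2 * ρ' ≤ r / 8 → ∀ (ω : BondConfig (Site 2)), (∃ u, dist (medialExplorationCurve D' ω u) z ≤ ρ') → ∃ v w : Site 2, dist (meshPoint D'.δ v) z ≤ ρ' + D'.δ ∧ r / 8 - D'.δ ≤ dist (meshPoint D'.δ w) z ∧ ω ∈ openConnIn (meshDomain D'.Ω D'.δ ∩ {y | dist (meshPoint D'.δ y) z ≤ r / 8 + D'.δ}) v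 w :=
  fun _ hadm _ _ hδr hends hside _ hρ'r _ hvisit =>
    touchExponent_inDomainArm_of_visit hadm hδr hends hside hρ'r hvisit

end Arms


/-! ### Lattice geometry of the diagonal wall -/

section Geometry

/-- Sites of the triangle, read at mesh `δ`, lie in the diagonal half-plane
`{v₀ + v₁ ≥ ⌊-1/δ⌋ + 1}`. -/
theorem touchExponent_level_le_hgtOf {δ : ℝ} (hδ : 0 < δ) {y : Site 2}
    (hy : meshPoint δ y ∈ {w : ℂ | w.re < 0 ∧ w.im < 0 ∧ -1 < w.re + w.im}) :
    ⌊-1 / δ⌋ + 1 ≤ hgtOf y := by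
  obtain ⟨-, -, h3⟩ := hy
  rw [meshPoint_re, meshPoint_im] at h3
  have h : -1 / δ < ((y 0 + y 1 : ℤ) : ℝ) := by
    rw [div_lt_iff₀ hδ]; push_cast; linarith
  have := Int.floor_lt.2 h
  simp only [hgtOf]; omega

/-- The base point `b = (⌊-1/(2δ)⌋, ⌊-1/δ⌋ + 1 - ⌊-1/(2δ)⌋)` of the wall is within `3δ` of
`z = -(1+i)/2`. -/
theorem touchExponent_dist_base_le {δ : ℝ} (hδ : 0 < δ) :
    dist (meshPoint δ ![⌊-1 / (2 * δ)⌋, ⌊-1 / δ⌋ + 1 - ⌊-1 / (2 * δ)⌋]) (-(1 + Complex.I) / 2) ≤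
      3 * δ := by
  set p := meshPoint δ ![⌊-1 / (2 * δ)⌋, ⌊-1 / δ⌋ + 1 - ⌊-1 / (2 * δ)⌋] with hp
  have h1 := Int.floor_le (-1 / (2 * δ))
  have h2 := Int.lt_floor_add_one (-1 / (2 * δ))
  have h3 := Int.floor_le (-1 / δ)
  have h4 := Int.lt_floor_add_one (-1 / δ)
  have e1 : δ * (-1 / (2 * δ)) = -1 / 2 := by field_simp
  have e2 : δ * (-1 / δ) = -1 := by field_simp
  have hre : |(p - -(1 + Complex.I) / 2).re| ≤ δ := by
    rw [hp, Complex.sub_re, meshPoint_re]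
    simp only [Matrix.cons_val_zero, Complex.neg_re, Complex.div_ofNat_re, Complex.add_re,
      Complex.one_re, Complex.I_re, add_zero]
    rw [abs_le]
    constructor <;> nlinarith [mul_le_mul_of_nonneg_left h1 hδ.le,
      mul_le_mul_of_nonneg_left h2.le hδ.le]
  have him : |(p - -(1 + Complex.I) / 2).im| ≤ 2 * δ := by
    rw [hp, Complex.sub_im, meshPoint_im]
    simp only [Matrix.cons_val_one, Matrix.cons_val_fin_one, Complex.neg_im, Complex.div_ofNat_im,
      Complex.add_im, Complex.one_im, Complex.I_im, zero_add, Int.cast_sub, Int.cast_add,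
      Int.cast_one]
    rw [abs_le]
    constructor <;> nlinarith [mul_le_mul_of_nonneg_left h1 hδ.le,
      mul_le_mul_of_nonneg_left h2.le hδ.le, mul_le_mul_of_nonneg_left h3 hδ.le,
      mul_le_mul_of_nonneg_left h4.le hδ.le]
  rw [Complex.dist_eq]
  linarith [Complex.norm_le_abs_re_add_abs_im (p - -(1 + Complex.I) / 2)]

/-- The half-plane norm is at most twice the rescaled Euclidean distance. -/
theorem touchExponent_norm_le_dist {δ : ℝ} (hδ : 0 < δ) (b y : Site 2) :
    ((max |col y - col b| (hgtOf y - hgtOf b) : ℤ) : ℝ) ≤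
      2 * dist (meshPoint δ y) (meshPoint δ b) / δ := by
  rw [le_div_iff₀ hδ, Complex.dist_eq]
  have hre := Complex.abs_re_le_norm (meshPoint δ y - meshPoint δ b)
  have him := Complex.abs_im_le_norm (meshPoint δ y - meshPoint δ b)
  rw [Complex.sub_re, meshPoint_re, meshPoint_re, ← mul_sub, abs_mul, abs_of_pos hδ] at hre
  rw [Complex.sub_im, meshPoint_im, meshPoint_im, ← mul_sub, abs_mul, abs_of_pos hδ] at him
  rw [Int.cast_max, Int.cast_abs]
  simp only [col, hgtOf, Int.cast_sub, Int.cast_add]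
  set u : ℝ := (y 0 : ℝ) - b 0 with hu
  set v : ℝ := (y 1 : ℝ) - b 1 with hv
  have e1 : ((y 0 : ℝ) - y 1 - ((b 0 : ℝ) - b 1)) = u - v := by rw [hu, hv]; ring
  have e2 : ((y 0 : ℝ) + y 1 - ((b 0 : ℝ) + b 1)) = u + v := by rw [hu, hv]; ring
  rw [e1, e2]
  have key : max |u - v| (u + v) ≤ |u| + |v| :=
    max_le (abs_sub u v) ((le_abs_self _).trans (abs_add_le u v))
  calc max |u - v| (u + v) * δ ≤ (|u| + |v|) * δ := mul_le_mul_of_nonneg_right key hδ.le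
    _ = δ * |u| + δ * |v| := by ring
    _ ≤ _ := by linarith

/-- In the half-plane above the base point, the rescaled Euclidean distance is at most twice the
half-plane norm. -/
theorem touchExponent_dist_le_norm {δ : ℝ} (hδ : 0 < δ) {b y : Site 2} (hby : hgtOf b ≤ hgtOf y) :
    dist (meshPoint δ y) (meshPoint δ b) ≤
      2 * δ * ((max |col y - col b| (hgtOf y - hgtOf b) : ℤ) : ℝ) := by
  rw [Complex.dist_eq]
  have hn := Complex.norm_le_abs_re_add_abs_im (meshPoint δ y - meshPoint δ b)
  rw [Complex.sub_re, meshPoint_re, meshPoint_re, ← mul_sub, abs_mul, abs_of_pos hδ,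
    Complex.sub_im, meshPoint_im, meshPoint_im, ← mul_sub, abs_mul, abs_of_pos hδ] at hn
  rw [Int.cast_max, Int.cast_abs]
  have hby' : ((hgtOf b : ℤ) : ℝ) ≤ hgtOf y := by exact_mod_cast hby
  simp only [col, hgtOf, Int.cast_sub, Int.cast_add] at hby' ⊢
  set u : ℝ := (y 0 : ℝ) - b 0 with hu
  set v : ℝ := (y 1 : ℝ) - b 1 with hv
  have e1 : ((y 0 : ℝ) - y 1 - ((b 0 : ℝ) - b 1)) = u - v := by rw [hu, hv]; ring
  have e2 : ((y 0 : ℝ) + y 1 - ((b 0 : ℝ) + b 1)) = u + v := by rw [hu, hv]; ring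
  rw [e1, e2]
  set M := max |u - v| (u + v) with hM
  have hg : 0 ≤ u + v := by rw [hu, hv]; linarith
  have hc : |u - v| ≤ M := le_max_left _ _
  have hg' : u + v ≤ M := le_max_right _ _
  have hu' : |u| ≤ M := by
    have : |2 * u| ≤ 2 * M := by
      calc |2 * u| = |(u + v) + (u - v)| := by ring_nf
        _ ≤ |u + v| + |u - v| := abs_add_le _ _
        _ ≤ M + M := by rw [abs_of_nonneg hg]; linarith
        _ = 2 * M := by ring
    rw [abs_mul, abs_two] at this
    linarith
  have hv' : |v| ≤ M := by
    have : |2 * v| ≤ 2 * M := by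
      calc |2 * v| = |(u + v) - (u - v)| := by ring_nf
        _ ≤ |u + v| + |u - v| := abs_sub _ _
        _ ≤ M + M := by rw [abs_of_nonneg hg]; linarith
        _ = 2 * M := by ring
    rw [abs_mul, abs_two] at this
    linarith
  calc ‖meshPoint δ y - meshPoint δ b‖ ≤ δ * |u| + δ * |v| := hn
    _ ≤ δ * M + δ * M := by gcongr
    _ = 2 * δ * M := by ring




/-- **Clipping an in-domain arm to the two-scale half-plane arm event.** On a lattice
configuration, an open connection inside a set `S ⊆ {hgtOf ≥ h}` from a site of half-plane norm
`≤ R₁` (seen from a base point `b` of the wall, `hgtOf b = h`) to a site of norm `≥ R₂` contains an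
open crossing of the half-annulus `{h ≤ hgtOf, R₁ ≤ ν_b ≤ R₂}` from `{ν_b = R₁}` to `{ν_b = R₂}`. -/
theorem touchExponent_clip_halfAnnulus {ω : BondConfig (Site 2)} (hω : ω ⊆ (zdGraph 2).edgeSet)
    {S : Set (Site 2)} {h : ℤ} (hS : ∀ y ∈ S, h ≤ hgtOf y) {b v w : Site 2}
    {R₁ R₂ : ℤ} (h12 : R₁ ≤ R₂) (hv : ν[b, v] ≤ R₁) (hw : R₂ ≤ ν[b, w])
    (hconn : ω ∈ openConnIn S v w) :
    ω ∈ openCrossing {y : Site 2 | h ≤ hgtOf y ∧ R₁ ≤ ν[b, y] ∧ ν[b, y] ≤ R₂}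
      {y : Site 2 | ν[b, y] = R₁} {y : Site 2 | ν[b, y] = R₂} := by
  obtain ⟨x', y', hx', hy', hc⟩ := exists_openConnIn_clip hω (fun y => ν[b, y])
    (HalfPlaneArm.norm_le_of_adj (X := col) (Y := hgtOf) HalfPlaneArm.diag_X_le
      HalfPlaneArm.diag_Y_le b) h12 hv hw hconn
  refine ⟨x', hx', y', hy', openConnIn_mono (fun y hy => ?_) _ _ hc⟩
  exact ⟨hS y hy.1, hy.2.1, hy.2.2⟩

/-- **Translation to level `0`.** A lattice translation by `t` carries the two-scale arm event of
the half-plane `{hgtOf ≥ 0}` based at `b'` onto the one of the half-plane `{hgtOf ≥ hgtOf t}`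
based at `b' + t`, preserving `P_{1/2}`. -/
theorem touchExponent_real_shift_level (t b' : Site 2) (r R : ℤ) :
    (μ).real (openCrossing
        {v : Site 2 | hgtOf t ≤ hgtOf v ∧ r ≤ ν[b' + t, v] ∧ ν[b' + t, v] ≤ R}
        {v : Site 2 | ν[b' + t, v] = r} {v : Site 2 | ν[b' + t, v] = R}) =
      (μ).real (openCrossing {v : Site 2 | 0 ≤ hgtOf v ∧ r ≤ ν[b', v] ∧ ν[b', v] ≤ R}
        {v : Site 2 | ν[b', v] = r} {v : Site 2 | ν[b', v] = R}) := by
  have e1 : ∀ v : Site 2, (0 ≤ hgtOf (v + -t)) ↔ hgtOf t ≤ hgtOf v := fun v => by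
    simp only [hgtOf, Pi.add_apply, Pi.neg_apply]; omega
  have e2 : ∀ v : Site 2, ν[b', v + -t] = ν[b' + t, v] := fun v => by
    have h1 : col (v + -t) - col b' = col v - col (b' + t) := by
      simp only [col, Pi.add_apply, Pi.neg_apply]; ring
    have h2 : hgtOf (v + -t) - hgtOf b' = hgtOf v - hgtOf (b' + t) := by
      simp only [hgtOf, Pi.add_apply, Pi.neg_apply]; ring
    rw [h1, h2]
  rw [← real_openCrossing_shift half t {v : Site 2 | 0 ≤ hgtOf v ∧ r ≤ ν[b', v] ∧ ν[b', v] ≤ R}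
    {v : Site 2 | ν[b', v] = r} {v : Site 2 | ν[b', v] = R}]
  simp only [Set.image_add_right]
  congr 2 <;> ext v <;> simp only [Set.mem_preimage, Set.mem_setOf_eq] <;> simp only [e2]
  simp only [e1]

end Geometry

end Summit.CriticalPhenomena.CardyFormulaZ2.Theorems.SymmetryUpgradeR.SwallowingSkeleton

end
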